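import Summits.QuantumFields.YangMills.Theorems.UnitScaleTiltProp7SectET3LandauOpRowsT3
import HarnessLib

/-!
# Route `UnitScaleTilt`, crux «MinimiserStabilityRegPr» (stmt-QuantumFields-19200, stub EX), node N06(d = 3), route (α) — LAYER 0, ROWS (def-free):
# **«OP-ROWS-127» — `hΔsol`'s SECOND-ORDER SUPPLIER WITH THE LANDAU MULTIPLIER KILLED BY (127), AT A GENERIC HESSIAN SLOT.**  The sibling of ✓`Prop7SectET3LandauOpRows` §5 ruled
# by the EX-knit namer ★ym-ust-19200-w2 g6 (G25) 2026-08-28 20:46:09Z after the two located display defects №5 (`PosPrime` EMPTY, ★px16 #54) and №6 («hOpC-CZ», ★px5 #55): the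
# `(1 − P₀*) + multiplier` row is SPLIT into the benign tube-field row `hOpC′` ([Balaban1985Variational] (133)'s `(1 − P₀*)`-term: `Qk†((QGQ*)⁻¹(Q_k(Gx)))` — sup-bounded by
# [Balaban1985BackgroundPropagators] (3.42) n = 0 × the `(QGQ*)⁻¹` row × the `Q` letters, η-free) and the VANISHING of the multiplier `hmult : D(R_S(D*(Gx))) = 0` at the solution's
# `x = Ĵ + Ŵ` (print's consequence of (127); (128)–(133) are written after (127), so print never meets the Calderón–Zygmund operator `DR_SD*G ∋ DΔ₀⁻¹D*`), and the Hessian slot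
# `Δx` is a VARIABLE with its two Landau guards `hkill`∕`horth` DISPLAYED (E2-133 §1's `hΔ hΔ′`) and `hp : PosOnto … Δx U₀` only — NO `PosPrime` — so that the same theorem
# instantiates at today's `DeltaPiSlot` and at the pseudo-inverse slot `DeltaPiSlotP` of cure (C2′) without re-typing

Cell `ym3-torus` (HUMAN RULING D-0037, YM ladder rung R3 — YM₃ on T³, NOT d = 4, NOT Clay; YM gap NOT proved), width seat `ym3-torus-px5` (gen 2; FILL-TO-CAP «width 5»); memo
`HOME/ym3-torus-px5/HAZARD-HOPC-CZ-px5g2.md` = stmt-QuantumFields-19200 evidence #55 (kit j317689).  THEOREMS ONLY (0 `def`, 0 `sorry`); `--supports stmt-QuantumFields-19200 --as helper`;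
count-neutral; NO claim on crux ∕ stub ∕ registry; nothing of [Balaban1985BackgroundPropagators] §3 is asserted — the rows ARE print's inputs, displayed by name.

THE DISPLAYED ROWS OF THE SUPPLIER (member `F`, `h : n ≤ K`, weights `c₀ cB a`, slot `Δx`, background `U₀`; all background-level except the one solution identity `hmult`):
* `hOpC′ : ∀ x bd, ‖toL2⁻¹(Qk†(KinvT …Δx… (Qk(GT …Δx… x)))) bd‖ ≤ cC′·‖toL2⁻¹x‖` — (133)'s `(1 − P₀*)`-operator, a TUBE field of coarse data.  INHABITABILITY (№9 (3)): letters `Qk KinvT GT toL2`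
  only; `x = 0` trivial; η-free content = (3.42) n = 0 (sup row of `G`) × Thm 3.11's `(QGQ*)⁻¹` row × `‖Qk‖`,`‖Qk†‖` (explicit) — N06 storey ∕ desk I-06; NO Calderón–Zygmund operator.
* `hmult : DL2(RS(DstarL2(GT …Δx… x))) = 0` at THE `x` of the solution — print's (127) ⟹ residual `∈ Ran Qk†` ⟹ multiplier `∈ Ran Qk† ∩ Ran(DL2∘RS) = {0}` ((3.124)₂); inhabited (it is
  what Sect. C proves); derivable at the knit level from the displayed `hCrit93′ + hSplit′` via ✓`Prop7Crit127OfCrit93Split.hCrit127_of_hCrit93_of_split127` (★px21 lineage).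
* `h137` generic-`Y` at the slot (✓`hΔH_of_rows'`'s text with `KinvT …Δx…`); `hOp139′ : ∀ X s, R_S(D*(toL2 X)) = 0 → (‖X‖ ≤ s) → ‖toL2⁻¹(Δ^η(toL2 X) − Δx(toL2 X)) bd‖ ≤ k₁₃₉·s` — THE
  SLOT-DEFECT ROW ((138)–(139) «|Δ′_πF|₍₋₃₎ ≦ O(1)·sup|F| on `RD*F = 0`», written slot-generically: at `Δx = Δ_π` on Landau `X`, `Δ^ηX − Δ_πX = (DG′R_SD*)†Δ^ηX` = ✓p663021's `hOp139` quantity;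
  inhabitable, η-free: ONE derivative on `G′`); `hOp349` (✓p663021's text, slot-free, η-free by (3.49)).
* sizes (the ONLY place the field enters): `hYsup`∕`hnY`, `hx`∕`hsx`, `hb`∕`hsb` (E2-133's pairs + the coarse datum's).

WHAT IS PROVED (ns `…Theorems.Prop7SectET3LandauOpRows127`):
* §1 `k_nonneg_of_opCprime`, ★`hCprime_of_opCprime` (generic row ⇒ `≤ cC′·sx` at one `x`), `k_nonneg_of_op137_slot`, ★`h137_of_genericY_slot`, `k_nonneg_of_op139prime` (slot-generic twins of ✓p663021 §5∕§2).
* §2 ★★ `norm_rhs127_le` — the (127)-reduced right side of E2-133's `slot_sol_eq`: `‖toL2⁻¹(−x + Qk†KinvTQkGx + D R_S D*Gx + Qk†KinvT b − Qk†(a•b)) bd‖ ≤ sx + cC′·sx + c₁₃₇·sb` (with `hmult`).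
* §3 ★★★ `secondOrder_of_eq111_opRows127` — BOTH second-order members of (19) for `Yf` with `toL2 Yf = −𝔊x + Hb` at the slot `Δx` (guards `hkill horth`, class `hp`), on `RegPr ε₀ U₀`:
  `‖D¹*D¹Yf‖ ≤ (sx + cC′·sx + c₁₃₇·sb + k₁₃₉·nY + 28ε₀·nY)·η²`, `‖Δ¹Yf‖ ≤ (… + k₃₄₉·nY + 4ε₀·nY)·η²` — via ✓`slot_sol_eq` (generic slot) + `hmult` + `hOp139′` + ✓`secondOrder_of_DeltaEta_row`
  + ✓`hDPD_of_op349` (Landau row of the solution ✓`RS_DstarL2_sol`, generic slot).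
* §4 ★★★ `secondOrder_of_eq111_opRows127_rho` — the junction currency `≤ MΔ·ρ·η²`, `MΔ := cx + cC′·cx + c₁₃₇·cb + k₁₃₉·B₁∕2 + 14B₁ + k₃₄₉·B₁∕2 + 2B₁` (same polynomial as ✓p663021 §5 with `cC ↦ cC′`).
HONEST SCOPE.  Compositions by name + triangle inequalities; the rows are NOT proved here (N06(d = 3) ∕ Sect. C); not a proof of any stub; nothing continuum ∕ OS ∕ mass-gap ∕ Clay.

References: T. Bałaban, CMP **102** (1985) 277–309 [Balaban1985Variational] ((111) p.294, (127) p.297, (128)–(137) pp.297–298, (138)–(140) p.299, (19) p.281); CMP **99** (1985) 389–434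
[Balaban1985BackgroundPropagators] ((3.26) p.395, (3.42) p.397, (3.49) p.399, (3.119)–(3.126) pp.419–420, (3.147) p.425, (3.153) p.426).
-/

set_option autoImplicit false

noncomputable section

open scoped InnerProductSpace ComplexConjugate Matrix.Norms.L2Operator

namespace Summit.QuantumFields.YangMills.Theorems.Prop7SectET3LandauOpRows127

open Literature.MathematicalPhysics.QuantumFieldTheory.Balaban1983to89
open Literature.MathematicalPhysics.QuantumFieldTheory.Balaban1983to89.T3ContinuumYM3Torus
open Literature.MathematicalPhysics.QuantumFieldTheory.Balaban1983to89.T3PrintedRegularMinimiser (RegPr)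
open T3SectALandauChart (eta eta_pos covDerivFwdT covCodiffCurlT covLapFormT covDivFormT bgUnits)
open B9SectCLatticeCarrier (Bond)
open B9Eq311L2Pairing (WL2)
open B11Eq103H1Complex (SiteL2K BondL2K)
open Summit.QuantumFields.YangMills.Theorems.Prop7SectET3Transport (periodsT3)
open Summit.QuantumFields.YangMills.Theorems.Prop7SectET3HilbertLetters (W₂ toL2 toL2S toL2B DL2 DstarL2)
open Summit.QuantumFields.YangMills.Theorems.Prop7SectET3GaugeProjector (NS RS)
open Summit.QuantumFields.YangMills.Theorems.Prop7SectET3WilsonHessian (DeltaEta)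
open Summit.QuantumFields.YangMills.Theorems.Prop7SectET3CurvedPropagators
open Summit.QuantumFields.YangMills.Theorems.Prop7SectET3DeltaPi
open Summit.QuantumFields.YangMills.Theorems.Prop7HessRowOfEq111 (RS_DstarL2_sol slot_sol_eq secondOrder_of_DeltaEta_row)
open Summit.QuantumFields.YangMills.Theorems.Prop7SectET3LandauOpRows (hDPD_of_op349 k_nonneg_of_op349)

variable {F : T3Family} {n K : ℕ} {h : n ≤ K} {c₀ cB a : ℝ} [Fact (0 < c₀)] [Fact (0 < cB)]
  {Δx : GaugeField (F.P K) 0 (Matrix.specialUnitaryGroup (Fin 2) ℂ) → (BondL2K ℂ 3 (periodsT3 F K) c₀ W₂ →ₗ[ℂ] BondL2K ℂ 3 (periodsT3 F K) c₀ W₂)}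

/-! ## §1 The generic rows read at one datum; non-negativity of their constants -/

/-- The constant of the benign `(1 − P₀*)` row `hOpC′` is non-negative (read the row at the constant field `1`). [cite: Balaban1985Variational, (133) p.298; Balaban1985BackgroundPropagators, (3.42) p.397] -/
theorem k_nonneg_of_opCprime (U₀ : GaugeField (F.P K) 0 (Matrix.specialUnitaryGroup (Fin 2) ℂ)) {cC : ℝ}
    (hOpC : ∀ (x : BondL2K ℂ 3 (periodsT3 F K) c₀ W₂) (bd : PBond (F.P K) 0),
      ‖(toL2 F K c₀).symm (LinearMap.adjoint (Qk F n K h c₀ cB U₀) (KinvT F n K h c₀ cB a Δx U₀ (Qk F n K h c₀ cB U₀ (GT F n K h c₀ cB a Δx U₀ x)))) bd‖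
        ≤ cC * ‖(toL2 F K c₀).symm x‖) :
    0 ≤ cC := by
  have hY : (fun _ : PBond (F.P K) 0 => (1 : Matrix (Fin 2) (Fin 2) ℂ)) ≠ 0 :=
    fun h0 => one_ne_zero (congrFun h0 ⟨default, ⟨0, (F.P K).hd⟩⟩)
  have hpos : 0 < ‖(fun _ : PBond (F.P K) 0 => (1 : Matrix (Fin 2) (Fin 2) ℂ))‖ := norm_pos_iff.mpr hY
  have h1 := hOpC (toL2 F K c₀ (fun _ => 1)) ⟨default, ⟨0, (F.P K).hd⟩⟩
  rw [LinearEquiv.symm_apply_apply] at h1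
  have h2 : 0 * ‖(fun _ : PBond (F.P K) 0 => (1 : Matrix (Fin 2) (Fin 2) ℂ))‖ ≤ cC * ‖(fun _ : PBond (F.P K) 0 => (1 : Matrix (Fin 2) (Fin 2) ℂ))‖ := by
    rw [zero_mul]; exact (norm_nonneg _).trans h1
  exact le_of_mul_le_mul_right h2 hpos

/-- ★ **THE BENIGN `(1 − P₀*)` ROW READ AT ONE `x`** with `‖toL2⁻¹x(bd)‖ ≤ sx`: `≤ cC′·sx`. [cite: Balaban1985Variational, (133) p.298; Balaban1985BackgroundPropagators, (3.42) p.397] -/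
theorem hCprime_of_opCprime (U₀ : GaugeField (F.P K) 0 (Matrix.specialUnitaryGroup (Fin 2) ℂ)) {cC sx : ℝ}
    (hOpC : ∀ (x : BondL2K ℂ 3 (periodsT3 F K) c₀ W₂) (bd : PBond (F.P K) 0),
      ‖(toL2 F K c₀).symm (LinearMap.adjoint (Qk F n K h c₀ cB U₀) (KinvT F n K h c₀ cB a Δx U₀ (Qk F n K h c₀ cB U₀ (GT F n K h c₀ cB a Δx U₀ x)))) bd‖
        ≤ cC * ‖(toL2 F K c₀).symm x‖)
    (x : BondL2K ℂ 3 (periodsT3 F K) c₀ W₂) (hx : ∀ bd, ‖(toL2 F K c₀).symm x bd‖ ≤ sx) (bd : PBond (F.P K) 0) :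
    ‖(toL2 F K c₀).symm (LinearMap.adjoint (Qk F n K h c₀ cB U₀) (KinvT F n K h c₀ cB a Δx U₀ (Qk F n K h c₀ cB U₀ (GT F n K h c₀ cB a Δx U₀ x)))) bd‖ ≤ cC * sx := by
  have hsx0 : 0 ≤ sx := (norm_nonneg _).trans (hx ⟨default, ⟨0, (F.P K).hd⟩⟩)
  exact (hOpC x bd).trans (mul_le_mul_of_nonneg_left ((pi_norm_le_iff_of_nonneg hsx0).mpr hx) (k_nonneg_of_opCprime (n := n) (h := h) (cB := cB) (a := a) U₀ hOpC))

/-- The constant of the generic-`Y` (137) row at the slot `Δx` is non-negative (read at the constant block field `1`). [cite: Balaban1985Variational, (137) p.298] -/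
theorem k_nonneg_of_op137_slot (U₀ : GaugeField (F.P K) 0 (Matrix.specialUnitaryGroup (Fin 2) ℂ)) {c137 : ℝ}
    (h137 : ∀ (Y : PBond (F.P n) 0 → Matrix (Fin 2) (Fin 2) ℂ) (b : PBond (F.P K) 0),
      ‖(toL2 F K c₀).symm (LinearMap.adjoint (Qk F n K h c₀ cB U₀) (KinvT F n K h c₀ cB a Δx U₀ (toL2B F n cB Y))
          - LinearMap.adjoint (Qk F n K h c₀ cB U₀) (((a : ℂ)) • toL2B F n cB Y)) b‖ ≤ c137 * ‖Y‖) :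
    0 ≤ c137 := by
  have hY : (fun _ : PBond (F.P n) 0 => (1 : Matrix (Fin 2) (Fin 2) ℂ)) ≠ 0 :=
    fun h0 => one_ne_zero (congrFun h0 ⟨default, ⟨0, (F.P n).hd⟩⟩)
  have hpos : 0 < ‖(fun _ : PBond (F.P n) 0 => (1 : Matrix (Fin 2) (Fin 2) ℂ))‖ := norm_pos_iff.mpr hY
  have h1 := h137 (fun _ => 1) ⟨default, ⟨0, (F.P K).hd⟩⟩
  have h2 : 0 * ‖(fun _ : PBond (F.P n) 0 => (1 : Matrix (Fin 2) (Fin 2) ℂ))‖ ≤ c137 * ‖(fun _ : PBond (F.P n) 0 => (1 : Matrix (Fin 2) (Fin 2) ℂ))‖ := by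
    rw [zero_mul]; exact (norm_nonneg _).trans h1
  exact le_of_mul_le_mul_right h2 hpos

/-- ★ **THE GENERIC-`Y` (137) ROW AT THE SLOT READ AT ONE COARSE DATUM `b`** with `‖toL2B⁻¹b(c)‖ ≤ sb`: `≤ c₁₃₇·sb`. [cite: Balaban1985Variational, (137) p.298; Balaban1985BackgroundPropagators, (3.126) p.420] -/
theorem h137_of_genericY_slot (U₀ : GaugeField (F.P K) 0 (Matrix.specialUnitaryGroup (Fin 2) ℂ)) {c137 sb : ℝ}
    (h137 : ∀ (Y : PBond (F.P n) 0 → Matrix (Fin 2) (Fin 2) ℂ) (b : PBond (F.P K) 0),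
      ‖(toL2 F K c₀).symm (LinearMap.adjoint (Qk F n K h c₀ cB U₀) (KinvT F n K h c₀ cB a Δx U₀ (toL2B F n cB Y))
          - LinearMap.adjoint (Qk F n K h c₀ cB U₀) (((a : ℂ)) • toL2B F n cB Y)) b‖ ≤ c137 * ‖Y‖)
    (b : WL2 ℂ (fun _ : PBond (F.P n) 0 => cB) W₂) (hb : ∀ c : PBond (F.P n) 0, ‖(toL2B F n cB).symm b c‖ ≤ sb) (bd : PBond (F.P K) 0) :
    ‖(toL2 F K c₀).symm (LinearMap.adjoint (Qk F n K h c₀ cB U₀) (KinvT F n K h c₀ cB a Δx U₀ b)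
        - LinearMap.adjoint (Qk F n K h c₀ cB U₀) (((a : ℂ)) • b)) bd‖ ≤ c137 * sb := by
  have hsb0 : 0 ≤ sb := (norm_nonneg _).trans (hb ⟨default, ⟨0, (F.P n).hd⟩⟩)
  have h1 := h137 ((toL2B F n cB).symm b) bd
  rw [LinearEquiv.apply_symm_apply] at h1
  exact h1.trans (mul_le_mul_of_nonneg_left ((pi_norm_le_iff_of_nonneg hsb0).mpr hb) (k_nonneg_of_op137_slot (h := h) U₀ h137))

omit [Fact (0 < cB)] in
/-- The constant of the SLOT-DEFECT row `hOp139′` is non-negative (the zero field is Landau; read the row at `X = 0`, `s = 1`). [cite: Balaban1985Variational, (139) p.299] -/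
theorem k_nonneg_of_op139prime (U₀ : GaugeField (F.P K) 0 (Matrix.specialUnitaryGroup (Fin 2) ℂ)) {k139 : ℝ}
    (hOp139 : ∀ (X : PBond (F.P K) 0 → Matrix (Fin 2) (Fin 2) ℂ) (s : ℝ), RS F n K h c₀ cB U₀ (DstarL2 F n K c₀ U₀ (toL2 F K c₀ X)) = 0 → (∀ bd, ‖X bd‖ ≤ s) →
      ∀ bd : PBond (F.P K) 0, ‖(toL2 F K c₀).symm (DeltaEta F n K c₀ U₀ (toL2 F K c₀ X) - Δx U₀ (toL2 F K c₀ X)) bd‖ ≤ k139 * s) :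
    0 ≤ k139 := by
  have h1 := hOp139 0 1 (by rw [map_zero, map_zero, map_zero]) (fun bd => by rw [Pi.zero_apply, norm_zero]; exact zero_le_one) ⟨default, ⟨0, (F.P K).hd⟩⟩
  rw [mul_one] at h1
  exact (norm_nonneg _).trans h1

/-! ## §2 The (127)-reduced right side of the slot row of the solution -/

/-- ★★ **THE SUP ROW OF THE (127)-REDUCED RIGHT SIDE** of ✓`slot_sol_eq`: with the multiplier killed (`hmult`), `‖toL2⁻¹(−x + Qk†KinvTQkGx + DR_SD*Gx + Qk†KinvT b − Qk†(a•b))(bd)‖ ≤ sx + cC′·sx + c₁₃₇·sb`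
from the benign row `hOpC′`, the generic-`Y` (137) row and the sizes of `x` and `b` — print's (133)+(137) sup arithmetic. [cite: Balaban1985Variational, (127) p.297, (133) p.298, (137) p.298] -/
theorem norm_rhs127_le (U₀ : GaugeField (F.P K) 0 (Matrix.specialUnitaryGroup (Fin 2) ℂ)) {cC c137 sx sb : ℝ}
    (x : BondL2K ℂ 3 (periodsT3 F K) c₀ W₂) (b : WL2 ℂ (fun _ : PBond (F.P n) 0 => cB) W₂)
    (hx : ∀ bd, ‖(toL2 F K c₀).symm x bd‖ ≤ sx) (hb : ∀ c : PBond (F.P n) 0, ‖(toL2B F n cB).symm b c‖ ≤ sb)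
    (hOpC : ∀ (x : BondL2K ℂ 3 (periodsT3 F K) c₀ W₂) (bd : PBond (F.P K) 0),
      ‖(toL2 F K c₀).symm (LinearMap.adjoint (Qk F n K h c₀ cB U₀) (KinvT F n K h c₀ cB a Δx U₀ (Qk F n K h c₀ cB U₀ (GT F n K h c₀ cB a Δx U₀ x)))) bd‖
        ≤ cC * ‖(toL2 F K c₀).symm x‖)
    (hmult : DL2 F n K c₀ U₀ (RS F n K h c₀ cB U₀ (DstarL2 F n K c₀ U₀ (GT F n K h c₀ cB a Δx U₀ x))) = 0)
    (h137 : ∀ (Y : PBond (F.P n) 0 → Matrix (Fin 2) (Fin 2) ℂ) (b : PBond (F.P K) 0),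
      ‖(toL2 F K c₀).symm (LinearMap.adjoint (Qk F n K h c₀ cB U₀) (KinvT F n K h c₀ cB a Δx U₀ (toL2B F n cB Y))
          - LinearMap.adjoint (Qk F n K h c₀ cB U₀) (((a : ℂ)) • toL2B F n cB Y)) b‖ ≤ c137 * ‖Y‖) (bd : PBond (F.P K) 0) :
    ‖(toL2 F K c₀).symm (-x + LinearMap.adjoint (Qk F n K h c₀ cB U₀) (KinvT F n K h c₀ cB a Δx U₀ (Qk F n K h c₀ cB U₀ (GT F n K h c₀ cB a Δx U₀ x)))
          + DL2 F n K c₀ U₀ (RS F n K h c₀ cB U₀ (DstarL2 F n K c₀ U₀ (GT F n K h c₀ cB a Δx U₀ x)))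
          + LinearMap.adjoint (Qk F n K h c₀ cB U₀) (KinvT F n K h c₀ cB a Δx U₀ b)
          - LinearMap.adjoint (Qk F n K h c₀ cB U₀) (((a : ℂ)) • b)) bd‖ ≤ sx + cC * sx + c137 * sb := by
  have hC := hCprime_of_opCprime (n := n) (h := h) (cB := cB) (a := a) U₀ hOpC x hx bd
  have hB := h137_of_genericY_slot (h := h) U₀ h137 b hb bd
  rw [hmult, add_zero]
  have hsplit : (toL2 F K c₀).symm (-x + LinearMap.adjoint (Qk F n K h c₀ cB U₀) (KinvT F n K h c₀ cB a Δx U₀ (Qk F n K h c₀ cB U₀ (GT F n K h c₀ cB a Δx U₀ x)))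
          + LinearMap.adjoint (Qk F n K h c₀ cB U₀) (KinvT F n K h c₀ cB a Δx U₀ b)
          - LinearMap.adjoint (Qk F n K h c₀ cB U₀) (((a : ℂ)) • b)) bd
      = -(toL2 F K c₀).symm x bd
        + (toL2 F K c₀).symm (LinearMap.adjoint (Qk F n K h c₀ cB U₀) (KinvT F n K h c₀ cB a Δx U₀ (Qk F n K h c₀ cB U₀ (GT F n K h c₀ cB a Δx U₀ x)))) bd
        + (toL2 F K c₀).symm (LinearMap.adjoint (Qk F n K h c₀ cB U₀) (KinvT F n K h c₀ cB a Δx U₀ b)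
            - LinearMap.adjoint (Qk F n K h c₀ cB U₀) (((a : ℂ)) • b)) bd := by
    simp only [map_add, map_sub, map_neg, Pi.add_apply, Pi.sub_apply, Pi.neg_apply]
    abel
  rw [hsplit]
  calc _ ≤ ‖-(toL2 F K c₀).symm x bd‖
          + ‖(toL2 F K c₀).symm (LinearMap.adjoint (Qk F n K h c₀ cB U₀) (KinvT F n K h c₀ cB a Δx U₀ (Qk F n K h c₀ cB U₀ (GT F n K h c₀ cB a Δx U₀ x)))) bd‖
          + ‖(toL2 F K c₀).symm (LinearMap.adjoint (Qk F n K h c₀ cB U₀) (KinvT F n K h c₀ cB a Δx U₀ b)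
              - LinearMap.adjoint (Qk F n K h c₀ cB U₀) (((a : ℂ)) • b)) bd‖ := norm_add₃_le
    _ ≤ sx + cC * sx + c137 * sb := by rw [norm_neg]; exact add_le_add (add_le_add (hx bd) hC) hB

/-! ## §3 Both second-order members of (19) for the solution, at a generic slot, multiplier killed -/

set_option maxHeartbeats 400000 in
-- HEARTBEAT rule (README): the statement carries the member's full letter terms (`LinearMap.adjoint (Qk …)`, `KinvT`, `GT`, `frakGT`, `HT`); sibling ✓p663021 §5 measured in the same class.
/-- ★★★ **`hΔsol`'s SUPPLIER, (127)-SPLIT, GENERIC SLOT** — for `Yf` with `toL2 Yf = −𝔊x + Hb` at the slot `Δx` (class `hp : PosOnto … Δx U₀`, Landau guards `hkill`∕`horth` of the slot), on `RegPr ε₀ U₀`,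
from the background-level rows `hOpC′` (benign `(1 − P₀*)`), `h137` (generic `Y`), `hOp139′` (slot defect on the Landau class), `hOp349` ((3.49)), the solution identity `hmult` ((127)'s
consequence) and the sizes `hYsup hx hb`: `‖D¹*D¹Yf‖ ≤ (sx + cC′·sx + c₁₃₇·sb + k₁₃₉·nY + 28ε₀·nY)·η²`, `‖Δ¹Yf‖ ≤ (… + k₃₄₉·nY + 4ε₀·nY)·η²`.  Chain: ✓`slot_sol_eq` (generic slot) + `hmult` ⇒
`Δx(toL2 Yf)` sup-bounded (§2); `Δ^η = Δx + (Δ^η − Δx)` with `hOp139′` at the Landau field `Yf` (✓`RS_DstarL2_sol`); ✓`secondOrder_of_DeltaEta_row` + ✓`hDPD_of_op349`.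
[cite: Balaban1985Variational, (111) p.294, (127) p.297, (133)–(137) p.298, (139)–(140) p.299, (19) p.281; Balaban1985BackgroundPropagators, (3.10) p.392, (3.26) p.395, (3.49) p.399, (3.124) p.420] -/
theorem secondOrder_of_eq111_opRows127 {ε₀ : ℝ} {U₀ : GaugeField (F.P K) 0 (Matrix.specialUnitaryGroup (Fin 2) ℂ)} (hU₀ : RegPr F n K ε₀ U₀)
    (hp : PosOnto F n K h c₀ cB a Δx U₀)
    (hkill : ∀ l ∈ NS F n K h c₀ cB U₀, Δx U₀ (DL2 F n K c₀ U₀ l) = 0) (horth : ∀ l ∈ NS F n K h c₀ cB U₀, ∀ w, ⟪DL2 F n K c₀ U₀ l, Δx U₀ w⟫_ℂ = 0)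
    (x : BondL2K ℂ 3 (periodsT3 F K) c₀ W₂) (b : WL2 ℂ (fun _ : PBond (F.P n) 0 => cB) W₂) (Yf : PBond (F.P K) 0 → Matrix (Fin 2) (Fin 2) ℂ)
    (hY : toL2 F K c₀ Yf = -(frakGT F n K h c₀ cB a Δx U₀ x) + HT F n K h c₀ cB a Δx U₀ b)
    {nY sx sb cC c137 k139 k349 : ℝ} (hYsup : ∀ bd, ‖Yf bd‖ ≤ nY)
    (hx : ∀ bd, ‖(toL2 F K c₀).symm x bd‖ ≤ sx) (hb : ∀ c : PBond (F.P n) 0, ‖(toL2B F n cB).symm b c‖ ≤ sb)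
    (hOpC : ∀ (x : BondL2K ℂ 3 (periodsT3 F K) c₀ W₂) (bd : PBond (F.P K) 0),
      ‖(toL2 F K c₀).symm (LinearMap.adjoint (Qk F n K h c₀ cB U₀) (KinvT F n K h c₀ cB a Δx U₀ (Qk F n K h c₀ cB U₀ (GT F n K h c₀ cB a Δx U₀ x)))) bd‖
        ≤ cC * ‖(toL2 F K c₀).symm x‖)
    (hmult : DL2 F n K c₀ U₀ (RS F n K h c₀ cB U₀ (DstarL2 F n K c₀ U₀ (GT F n K h c₀ cB a Δx U₀ x))) = 0)
    (h137 : ∀ (Y : PBond (F.P n) 0 → Matrix (Fin 2) (Fin 2) ℂ) (b : PBond (F.P K) 0),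
      ‖(toL2 F K c₀).symm (LinearMap.adjoint (Qk F n K h c₀ cB U₀) (KinvT F n K h c₀ cB a Δx U₀ (toL2B F n cB Y))
          - LinearMap.adjoint (Qk F n K h c₀ cB U₀) (((a : ℂ)) • toL2B F n cB Y)) b‖ ≤ c137 * ‖Y‖)
    (hOp139 : ∀ (X : PBond (F.P K) 0 → Matrix (Fin 2) (Fin 2) ℂ) (s : ℝ), RS F n K h c₀ cB U₀ (DstarL2 F n K c₀ U₀ (toL2 F K c₀ X)) = 0 → (∀ bd, ‖X bd‖ ≤ s) →
      ∀ bd : PBond (F.P K) 0, ‖(toL2 F K c₀).symm (DeltaEta F n K c₀ U₀ (toL2 F K c₀ X) - Δx U₀ (toL2 F K c₀ X)) bd‖ ≤ k139 * s)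
    (hOp349 : ∀ (X : PBond (F.P K) 0 → Matrix (Fin 2) (Fin 2) ℂ) (s : ℝ), (∀ bd, ‖X bd‖ ≤ s) → ∀ bd : PBond (F.P K) 0,
      ‖(toL2 F K c₀).symm (DL2 F n K c₀ U₀ (DstarL2 F n K c₀ U₀ (toL2 F K c₀ X) - RS F n K h c₀ cB U₀ (DstarL2 F n K c₀ U₀ (toL2 F K c₀ X)))) bd‖ ≤ k349 * s) :
    (∀ (μ : Fin (F.P K).d) (y : Site (F.P K) 0),
      ‖covCodiffCurlT 1 (bgUnits F K U₀) Yf μ y‖ ≤ (sx + cC * sx + c137 * sb + k139 * nY + 28 * ε₀ * nY) * eta F n K ^ 2) ∧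
    (∀ (ν : Fin (F.P K).d) (y : Site (F.P K) 0),
      ‖covLapFormT 1 (bgUnits F K U₀) Yf ν y‖ ≤ (sx + cC * sx + c137 * sb + k139 * nY + 28 * ε₀ * nY + k349 * nY + 4 * ε₀ * nY) * eta F n K ^ 2) := by
  -- the solution is a Landau field (generic slot)
  have hL : RS F n K h c₀ cB U₀ (DstarL2 F n K c₀ U₀ (toL2 F K c₀ Yf)) = 0 := by
    rw [hY]; exact RS_DstarL2_sol hp hkill horth x b
  -- the slot row of the solution, multiplier killed, and its sup row
  have hslot := slot_sol_eq hp hkill horth x b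
  rw [← hY] at hslot
  have hrhs := norm_rhs127_le (n := n) (h := h) U₀ x b hx hb hOpC hmult h137
  -- `Δ^η = Δx + (Δ^η − Δx)` at the solution
  have hZ : DeltaEta F n K c₀ U₀ (toL2 F K c₀ Yf)
      = Δx U₀ (toL2 F K c₀ Yf) + (DeltaEta F n K c₀ U₀ (toL2 F K c₀ Yf) - Δx U₀ (toL2 F K c₀ Yf)) := by abel
  refine secondOrder_of_DeltaEta_row hU₀ Yf _ hZ hYsup (fun bd => ?_) (hDPD_of_op349 (h := h) (cB := cB) U₀ hOp349 Yf hL hYsup)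
  rw [map_add, Pi.add_apply]
  refine (norm_add_le _ _).trans (add_le_add ?_ (hOp139 Yf nY hL hYsup bd))
  rw [hslot]
  exact hrhs bd

/-! ## §4 The junction currency `≤ MΔ·ρ·η²` -/

set_option maxHeartbeats 400000 in
-- HEARTBEAT rule (README): as above (full letter terms in the statement).
/-- ★★★ **THE JUNCTION CURRENCY, (127)-SPLIT, GENERIC SLOT** — with the sizes ρ-small (`nY ≤ B₁∕2·ρ`, `sx ≤ cx·ρ`, `sb ≤ cb·ρ`, `ρ ≤ 1` the `RegPr` radius) both second-order members of (19) for
`Yf` are `≤ MΔ·ρ·η²`, **`MΔ := cx + cC′·cx + c₁₃₇·cb + k₁₃₉·B₁∕2 + 14B₁ + k₃₄₉·B₁∕2 + 2B₁`** (✓p663021 §5's polynomial with `cC ↦ cC′`); displayed: `hOpC′ hmult h137 hOp139′ hOp349` + the slot's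
`hp hkill horth`. [cite: Balaban1985Variational, (127) p.297, (136) p.298, p.299 ll.6–21, (19) p.281; Balaban1985BackgroundPropagators, (3.42) p.397, (3.49) p.399] -/
theorem secondOrder_of_eq111_opRows127_rho {ρ : ℝ} (hρ : 0 ≤ ρ) (hρ1 : ρ ≤ 1) {U₀ : GaugeField (F.P K) 0 (Matrix.specialUnitaryGroup (Fin 2) ℂ)} (hU₀ : RegPr F n K ρ U₀)
    (hp : PosOnto F n K h c₀ cB a Δx U₀)
    (hkill : ∀ l ∈ NS F n K h c₀ cB U₀, Δx U₀ (DL2 F n K c₀ U₀ l) = 0) (horth : ∀ l ∈ NS F n K h c₀ cB U₀, ∀ w, ⟪DL2 F n K c₀ U₀ l, Δx U₀ w⟫_ℂ = 0)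
    (x : BondL2K ℂ 3 (periodsT3 F K) c₀ W₂) (b : WL2 ℂ (fun _ : PBond (F.P n) 0 => cB) W₂) (Yf : PBond (F.P K) 0 → Matrix (Fin 2) (Fin 2) ℂ)
    (hY : toL2 F K c₀ Yf = -(frakGT F n K h c₀ cB a Δx U₀ x) + HT F n K h c₀ cB a Δx U₀ b)
    {nY sx sb B₁ cx cb cC c137 k139 k349 : ℝ} (hYsup : ∀ bd, ‖Yf bd‖ ≤ nY) (hnY : nY ≤ B₁ / 2 * ρ)
    (hx : ∀ bd, ‖(toL2 F K c₀).symm x bd‖ ≤ sx) (hsx : sx ≤ cx * ρ)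
    (hb : ∀ c : PBond (F.P n) 0, ‖(toL2B F n cB).symm b c‖ ≤ sb) (hsb : sb ≤ cb * ρ)
    (hOpC : ∀ (x : BondL2K ℂ 3 (periodsT3 F K) c₀ W₂) (bd : PBond (F.P K) 0),
      ‖(toL2 F K c₀).symm (LinearMap.adjoint (Qk F n K h c₀ cB U₀) (KinvT F n K h c₀ cB a Δx U₀ (Qk F n K h c₀ cB U₀ (GT F n K h c₀ cB a Δx U₀ x)))) bd‖
        ≤ cC * ‖(toL2 F K c₀).symm x‖)
    (hmult : DL2 F n K c₀ U₀ (RS F n K h c₀ cB U₀ (DstarL2 F n K c₀ U₀ (GT F n K h c₀ cB a Δx U₀ x))) = 0)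
    (h137 : ∀ (Y : PBond (F.P n) 0 → Matrix (Fin 2) (Fin 2) ℂ) (b : PBond (F.P K) 0),
      ‖(toL2 F K c₀).symm (LinearMap.adjoint (Qk F n K h c₀ cB U₀) (KinvT F n K h c₀ cB a Δx U₀ (toL2B F n cB Y))
          - LinearMap.adjoint (Qk F n K h c₀ cB U₀) (((a : ℂ)) • toL2B F n cB Y)) b‖ ≤ c137 * ‖Y‖)
    (hOp139 : ∀ (X : PBond (F.P K) 0 → Matrix (Fin 2) (Fin 2) ℂ) (s : ℝ), RS F n K h c₀ cB U₀ (DstarL2 F n K c₀ U₀ (toL2 F K c₀ X)) = 0 → (∀ bd, ‖X bd‖ ≤ s) →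
      ∀ bd : PBond (F.P K) 0, ‖(toL2 F K c₀).symm (DeltaEta F n K c₀ U₀ (toL2 F K c₀ X) - Δx U₀ (toL2 F K c₀ X)) bd‖ ≤ k139 * s)
    (hOp349 : ∀ (X : PBond (F.P K) 0 → Matrix (Fin 2) (Fin 2) ℂ) (s : ℝ), (∀ bd, ‖X bd‖ ≤ s) → ∀ bd : PBond (F.P K) 0,
      ‖(toL2 F K c₀).symm (DL2 F n K c₀ U₀ (DstarL2 F n K c₀ U₀ (toL2 F K c₀ X) - RS F n K h c₀ cB U₀ (DstarL2 F n K c₀ U₀ (toL2 F K c₀ X)))) bd‖ ≤ k349 * s) :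
    (∀ (μ : Fin (F.P K).d) (y : Site (F.P K) 0),
      ‖covCodiffCurlT 1 (bgUnits F K U₀) Yf μ y‖ ≤ (cx + cC * cx + c137 * cb + k139 * B₁ / 2 + 14 * B₁ + k349 * B₁ / 2 + 2 * B₁) * ρ * eta F n K ^ 2) ∧
    (∀ (ν : Fin (F.P K).d) (y : Site (F.P K) 0),
      ‖covLapFormT 1 (bgUnits F K U₀) Yf ν y‖ ≤ (cx + cC * cx + c137 * cb + k139 * B₁ / 2 + 14 * B₁ + k349 * B₁ / 2 + 2 * B₁) * ρ * eta F n K ^ 2) := by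
  obtain ⟨h1, h2⟩ := secondOrder_of_eq111_opRows127 hU₀ hp hkill horth x b Yf hY hYsup hx hb hOpC hmult h137 hOp139 hOp349
  have hη2 : 0 ≤ eta F n K ^ 2 := sq_nonneg _
  have hkC : 0 ≤ cC := k_nonneg_of_opCprime (n := n) (h := h) (cB := cB) (a := a) U₀ hOpC
  have hk137 : 0 ≤ c137 := k_nonneg_of_op137_slot (h := h) U₀ h137
  have hk139 : 0 ≤ k139 := k_nonneg_of_op139prime (h := h) (cB := cB) U₀ hOp139
  have hk349 : 0 ≤ k349 := k_nonneg_of_op349 (n := n) (h := h) (cB := cB) U₀ hOp349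
  have hnY0 : 0 ≤ nY := (norm_nonneg _).trans (hYsup ⟨default, ⟨0, (F.P K).hd⟩⟩)
  have hB : 0 ≤ B₁ / 2 * ρ := hnY0.trans hnY
  have e1 : sx + cC * sx + c137 * sb + k139 * nY ≤ (cx + cC * cx + c137 * cb + k139 * B₁ / 2) * ρ := by
    have a1 : cC * sx ≤ cC * (cx * ρ) := mul_le_mul_of_nonneg_left hsx hkC
    have a2 : c137 * sb ≤ c137 * (cb * ρ) := mul_le_mul_of_nonneg_left hsb hk137
    have a3 : k139 * nY ≤ k139 * (B₁ / 2 * ρ) := mul_le_mul_of_nonneg_left hnY hk139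
    nlinarith
  have e2 : 28 * ρ * nY ≤ 14 * B₁ * ρ := by
    have a1 : 28 * ρ * nY ≤ 28 * ρ * (B₁ / 2 * ρ) := mul_le_mul_of_nonneg_left hnY (by positivity)
    have a2 : 28 * ρ * (B₁ / 2 * ρ) ≤ 28 * 1 * (B₁ / 2 * ρ) := mul_le_mul_of_nonneg_right (mul_le_mul_of_nonneg_left hρ1 (by norm_num)) hB
    nlinarith
  have e3 : k349 * nY ≤ k349 * B₁ / 2 * ρ := (mul_le_mul_of_nonneg_left hnY hk349).trans_eq (by ring)
  have e4 : 4 * ρ * nY ≤ 2 * B₁ * ρ := by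
    have a1 : 4 * ρ * nY ≤ 4 * ρ * (B₁ / 2 * ρ) := mul_le_mul_of_nonneg_left hnY (by positivity)
    have a2 : 4 * ρ * (B₁ / 2 * ρ) ≤ 4 * 1 * (B₁ / 2 * ρ) := mul_le_mul_of_nonneg_right (mul_le_mul_of_nonneg_left hρ1 (by norm_num)) hB
    nlinarith
  refine ⟨fun μ y => (h1 μ y).trans ?_, fun ν y => (h2 ν y).trans ?_⟩
  · have hs : sx + cC * sx + c137 * sb + k139 * nY + 28 * ρ * nY ≤ (cx + cC * cx + c137 * cb + k139 * B₁ / 2 + 14 * B₁ + k349 * B₁ / 2 + 2 * B₁) * ρ := by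
      have hk : 0 ≤ k349 * B₁ / 2 * ρ := by
        have := mul_nonneg hk349 hB; linarith [this, e3, mul_nonneg hk349 hnY0]
      nlinarith
    calc (sx + cC * sx + c137 * sb + k139 * nY + 28 * ρ * nY) * eta F n K ^ 2
        ≤ ((cx + cC * cx + c137 * cb + k139 * B₁ / 2 + 14 * B₁ + k349 * B₁ / 2 + 2 * B₁) * ρ) * eta F n K ^ 2 := mul_le_mul_of_nonneg_right hs hη2
      _ = _ := by ring
  · have hs : sx + cC * sx + c137 * sb + k139 * nY + 28 * ρ * nY + k349 * nY + 4 * ρ * nY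
        ≤ (cx + cC * cx + c137 * cb + k139 * B₁ / 2 + 14 * B₁ + k349 * B₁ / 2 + 2 * B₁) * ρ := by nlinarith
    calc (sx + cC * sx + c137 * sb + k139 * nY + 28 * ρ * nY + k349 * nY + 4 * ρ * nY) * eta F n K ^ 2
        ≤ ((cx + cC * cx + c137 * cb + k139 * B₁ / 2 + 14 * B₁ + k349 * B₁ / 2 + 2 * B₁) * ρ) * eta F n K ^ 2 := mul_le_mul_of_nonneg_right hs hη2
      _ = _ := by ring

end Summit.QuantumFields.YangMills.Theorems.Prop7SectET3LandauOpRows127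

end
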